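import Literature.Probability.RandomPlanarGeometry.LoewnerMoebiusConjugation
import Mathlib.MeasureTheory.Integral.IntervalIntegral.FundThmCalculus
import Mathlib.MeasureTheory.Integral.IntervalIntegral.IntegrationByParts
import Mathlib.Analysis.SpecialFunctions.ExpDeriv
import Mathlib.Analysis.Calculus.Deriv.Inverse
import Mathlib.Analysis.Calculus.Deriv.MeanValue
import Mathlib.Topology.Homeomorph.Lemmas
import HarnessLib

/-!
# The Möbius conjugation of the chordal Loewner flow: pole data, image driver and capacity clock

Topic `Probability/RandomPlanarGeometry`. Deterministic calculus behind the locality computation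
of G. F. Lawler, *Conformally Invariant Processes in the Plane* (2005), §4.6.1 and §6.3
(Thm. 6.13, Prop. 6.14; tree: `sle_six_moebius_locality`, `SLESixMoebiusLocality.lean`), for the
MÖBIUS map `N(y) = a + b/(p - y)` of `ℍ` (`LoewnerMoebiusConjugation.lean`: the conjugating maps
`h_t = g̃ ∘ N ∘ g_t⁻¹` are `moebiusConj a b P d₁ d₂`, explicit in the pole flow `P = g_t(p)` and
the jets `d₁`, `d₂` of `g_t` at the pole, and their algebra: the image Loewner equation
`hasDerivAt_moebiusConjC_trajectory`, the `κ = 6` cancellation `moebiusConj_drift_six`).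

Here the pole data are produced by QUADRATURES from one real path `X : ℝ → ℝ` — the gap
`X_u = g_u(p) - W_u` between the pole flow and the driving function (for the Loewner flow this is
the real flow of `p` seen from the driving point, `Loewner.realFlowStop`; in this file `X` is any
continuous nowhere-vanishing path, which is what the clamped gap of a Loewner chain is before the
swallowing time of the pole):

* `poleFlow p X u = p + ∫₀ᵘ 2/X` (`= g_u(p)`: the real Loewner equation integrated),
  `poleDeriv X u = exp(-∫₀ᵘ 2/X²)` (`= g_u'(p)`, Lawler (4.7)), `poleRatio X u = ∫₀ᵘ 4 d₁/X³`
  (`= g_u''(p)/g_u'(p)`) and `poleDeriv₂ = poleDeriv · poleRatio`; they satisfy BY CONSTRUCTION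
  the `x`-derivatives of Loewner's equation at the pole, `Ṗ = 2/X`, `ḋ₁ = -2 d₁/X²`,
  `ḋ₂ = -2 d₂/X² + 4 d₁²/X³` (`hasDerivAt_poleFlow`, `hasDerivAt_poleDeriv`,
  `hasDerivAt_poleDeriv₂`), which is all the algebra of `LoewnerMoebiusConjugation` consumes;
* `farPoint a b X u = a - (b/2) poleRatio X u` (`= h_u(∞)`, the image flow of the real point
  `a = N(∞)`), `driver a b X u = farPoint + b d₁/X` (`= h_u(W_u)`, the driving function of the
  image chain read in the ORIGINAL time; `driver_eq_moebiusConj`), `conjMap a b p X u`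
  (`= h_u` at complex arguments);
* the **capacity clock** `clock b X u = ∫₀ᵘ rate`, `rate = (b d₁/X²)² = h_u'(W_u)²` (Lawler §6.3:
  "define the change of time `r(t)` by `t = ∫₀^{r(t)} Φ_s'(U_s)² ds`"), strictly increasing, and
  its inverse `invClock` (levels clamped to `[clock(-1), clock(u₁+1)]`, after the pattern of
  `RadialChordalConjugation`), continuous, monotone, with `invClock' = 1/rate`;
* **the image flow solves Loewner's equation in capacity time**
  (`hasDerivAt_conjMap_invClock`): if `Y` solves `Ẏ = 2/(Y - W_u)` at `u = invClock t`
  (`W_u = P_u - X_u`), then `t ↦ h_{invClock t}(Y_{invClock t})` has derivative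
  `2/(h(Y) - driver)` at `t`; and the image far point `t ↦ farPoint (invClock t)` solves the REAL
  Loewner equation driven by `driver ∘ invClock` (`hasDerivAt_farPoint_invClock`);
* `timeChangedDriver a b X u₁ : ℝ≥0 → ℝ`, the image driving function in capacity time
  (`driver ∘ invClock`), continuous, with `timeChangedDriver (clock u) = driver u`.

Nothing here mentions Loewner chains or probability: the identification of these objects with the
Möbius image of an actual Loewner chain (hulls, maps, trace) is the sequel
`LoewnerMoebiusImageChain`, and the stochastic calculus of `driver` for `X` the SLE₆ flow is the
business of `SLESixMoebiusLocality*`.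

## References

* G. F. Lawler, *Conformally Invariant Processes in the Plane*, AMS (2005), §4.6.1 (Prop. 4.40,
  (4.35)), §6.3 (Thm. 6.13, Prop. 6.14). [Lawler2005]
* O. Schramm, D. B. Wilson, *SLE coordinate changes*, New York J. Math. 11 (2005), §4 (the same
  clock/inverse-clock bookkeeping for the radial–chordal change). [SchrammWilson2005]
-/

noncomputable section

open Set Filter Topology MeasureTheory intervalIntegral

namespace Literature.Probability.RandomPlanarGeometry

namespace MoebiusPole

/-! ### The pole data by quadratures -/

section Defs

variable (a b p : ℝ) (X : ℝ → ℝ)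

/-- **The pole flow** `P_u = p + ∫₀ᵘ 2/X_s ds` (`= g_u(p)`, the real Loewner equation
`Ṗ = 2/(P - W) = 2/X` integrated from the pole `p`). [cite: Lawler2005, §4.6.1] -/
def poleFlow (u : ℝ) : ℝ :=
  p + ∫ s in (0 : ℝ)..u, 2 / X s

/-- **The first jet at the pole** `d₁(u) = exp(-∫₀ᵘ 2/X_s² ds)` (`= g_u'(p)`, Lawler's (4.7)
`∂ₜ log g_t' = -2/(g_t - U_t)²` integrated). [cite: Lawler2005, §4.6.1] -/
def poleDeriv (u : ℝ) : ℝ :=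
  Real.exp (-∫ s in (0 : ℝ)..u, 2 / X s ^ 2)

/-- **The jet ratio** `E_u = ∫₀ᵘ 4 d₁(s)/X_s³ ds` (`= g_u''(p)/g_u'(p)`). [cite: Lawler2005, §4.6.1] -/
def poleRatio (u : ℝ) : ℝ :=
  ∫ s in (0 : ℝ)..u, 4 * poleDeriv X s / X s ^ 3

/-- **The second jet at the pole** `d₂ = d₁ E` (`= g_u''(p)`). [cite: Lawler2005, §4.6.1] -/
def poleDeriv₂ (u : ℝ) : ℝ :=
  poleDeriv X u * poleRatio X u

/-- **The image far point** `A_u = a - (b/2) E_u` (`= h_u(∞)`, the value of the conjugating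
Möbius map `h_u = a - b d₂/(2d₁) + b d₁/(P - ·)` at infinity; the image flow of the real point
`a = N(∞)` under the image chain). [cite: Lawler2005, §4.6.1] -/
def farPoint (u : ℝ) : ℝ :=
  a - b / 2 * poleRatio X u

/-- **The image driving function in the original time** `W̃_u = h_u(W_u) = A_u + b d₁(u)/X_u`
(Lawler §6.3: `U*_t = Φ_t(U_t)`; `driver_eq_moebiusConj`). [cite: Lawler2005, §6.3] -/
def driver (u : ℝ) : ℝ :=
  farPoint a b X u + b * poleDeriv X u / X u

/-- **The rate of the capacity clock** `rate = (b d₁/X²)² = h_u'(W_u)²`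
(`h_u'(y) = b d₁/(P - y)²`, `hasDerivAt_moebiusConj`). [cite: Lawler2005, §6.3] -/
def rate (u : ℝ) : ℝ :=
  (b * poleDeriv X u / X u ^ 2) ^ 2

/-- **The capacity clock** `clock u = ∫₀ᵘ h_s'(W_s)² ds` (half the half-plane capacity of the image
hull; Lawler §6.3: "`t = ∫₀^{r(t)} Φ_s'(U_s)² ds`"). [cite: Lawler2005, §6.3] -/
def clock (u : ℝ) : ℝ :=
  ∫ s in (0 : ℝ)..u, rate b X s

/-- **The conjugating Möbius map `h_u` at complex arguments**, with the pole data of `X`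
(`moebiusConjC` of `LoewnerMoebiusConjugation`). [cite: Lawler2005, §4.6.1] -/
def conjMap (u : ℝ) (z : ℂ) : ℂ :=
  moebiusConjC a b (poleFlow p X u) (poleDeriv X u) (poleDeriv₂ X u) z

end Defs

/-! ### Calculus of the pole data -/

section Calculus

variable {a b p : ℝ} {X : ℝ → ℝ} (hX : Continuous X) (hX0 : ∀ u, X u ≠ 0)

/-- `P_0 = p`. [folklore] -/
theorem poleFlow_zero : poleFlow p X 0 = p := by
  simp [poleFlow]

/-- `d₁(0) = 1`. [folklore] -/
theorem poleDeriv_zero : poleDeriv X 0 = 1 := by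
  simp [poleDeriv]

/-- `d₁ > 0`. [folklore] -/
theorem poleDeriv_pos (u : ℝ) : 0 < poleDeriv X u :=
  Real.exp_pos _

/-- `E_0 = 0`. [folklore] -/
theorem poleRatio_zero : poleRatio X 0 = 0 := by
  simp [poleRatio]

/-- `d₂(0) = 0`. [folklore] -/
theorem poleDeriv₂_zero : poleDeriv₂ X 0 = 0 := by
  simp [poleDeriv₂, poleRatio_zero]

/-- `A_0 = a`. [folklore] -/
theorem farPoint_zero : farPoint a b X 0 = a := by
  simp [farPoint, poleRatio_zero]

/-- `W̃_0 = a + b/X_0 = N(W_0)` (`N(y) = a + b/(p - y)`, `X_0 = p - W_0`). [folklore] -/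
theorem driver_zero : driver a b X 0 = a + b / X 0 := by
  simp [driver, farPoint_zero, poleDeriv_zero]

/-- `clock 0 = 0`. [folklore] -/
theorem clock_zero : clock b X 0 = 0 := by
  simp [clock]

/-- `A_u - W̃_u = -b d₁(u)/X_u` (the image of the tracked real point seen from the image driving
function). [folklore] -/
theorem farPoint_sub_driver (u : ℝ) :
    farPoint a b X u - driver a b X u = -(b * poleDeriv X u / X u) := by
  rw [driver]
  ring

include hX hX0

/-- `s ↦ 2/X_s` is continuous. [folklore] -/
theorem continuous_two_div : Continuous fun s ↦ 2 / X s :=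
  continuous_const.div hX hX0

/-- **`Ṗ = 2/X`.** [folklore] -/
theorem hasDerivAt_poleFlow (u : ℝ) : HasDerivAt (poleFlow p X) (2 / X u) u := by
  have h := ((continuous_two_div hX hX0).integral_hasStrictDerivAt 0 u).hasDerivAt
  exact h.const_add p

/-- `P` is continuous. [folklore] -/
theorem continuous_poleFlow : Continuous (poleFlow p X) :=
  continuous_iff_continuousAt.2 fun u ↦ (hasDerivAt_poleFlow hX hX0 u).continuousAt

/-- The integrand of `d₁` is continuous. [folklore] -/
theorem continuous_poleDeriv_integrand : Continuous fun s ↦ 2 / X s ^ 2 :=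
  continuous_const.div (hX.pow 2) fun s ↦ pow_ne_zero 2 (hX0 s)

/-- **`ḋ₁ = -2 d₁/X²`.** [folklore] -/
theorem hasDerivAt_poleDeriv (u : ℝ) :
    HasDerivAt (poleDeriv X) (-2 * poleDeriv X u / X u ^ 2) u := by
  have h1 := ((continuous_poleDeriv_integrand hX hX0).integral_hasStrictDerivAt 0 u).hasDerivAt
  have h2 : HasDerivAt (fun x ↦ Real.exp (-∫ s in (0 : ℝ)..x, 2 / X s ^ 2))
      (Real.exp (-∫ s in (0 : ℝ)..u, 2 / X s ^ 2) * -(2 / X u ^ 2)) u := h1.neg.exp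
  refine h2.congr_deriv ?_
  rw [poleDeriv]
  ring

/-- `d₁` is continuous. [folklore] -/
theorem continuous_poleDeriv : Continuous (poleDeriv X) :=
  continuous_iff_continuousAt.2 fun u ↦ (hasDerivAt_poleDeriv hX hX0 u).continuousAt

/-- The integrand of `E` is continuous. [folklore] -/
theorem continuous_poleRatio_integrand : Continuous fun s ↦ 4 * poleDeriv X s / X s ^ 3 :=
  (continuous_const.mul (continuous_poleDeriv hX hX0)).div (hX.pow 3)
    fun s ↦ pow_ne_zero 3 (hX0 s)

/-- **`Ė = 4 d₁/X³`.** [folklore] -/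
theorem hasDerivAt_poleRatio (u : ℝ) :
    HasDerivAt (poleRatio X) (4 * poleDeriv X u / X u ^ 3) u :=
  ((continuous_poleRatio_integrand hX hX0).integral_hasStrictDerivAt 0 u).hasDerivAt

/-- `E` is continuous. [folklore] -/
theorem continuous_poleRatio : Continuous (poleRatio X) :=
  continuous_iff_continuousAt.2 fun u ↦ (hasDerivAt_poleRatio hX hX0 u).continuousAt

/-- **`ḋ₂ = -2 d₂/X² + 4 d₁²/X³`** (the second `x`-derivative of Loewner's equation at the pole,
here by the product rule from `d₂ = d₁ E`). [cite: Lawler2005, §4.6.1] -/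
theorem hasDerivAt_poleDeriv₂ (u : ℝ) :
    HasDerivAt (poleDeriv₂ X)
      (-2 * poleDeriv₂ X u / X u ^ 2 + 4 * poleDeriv X u ^ 2 / X u ^ 3) u := by
  have h := (hasDerivAt_poleDeriv hX hX0 u).mul (hasDerivAt_poleRatio hX hX0 u)
  refine h.congr_deriv ?_
  rw [poleDeriv₂]
  ring

/-- `d₂` is continuous. [folklore] -/
theorem continuous_poleDeriv₂ : Continuous (poleDeriv₂ X) :=
  (continuous_poleDeriv hX hX0).mul (continuous_poleRatio hX hX0)

/-- **`Ȧ = -2 b d₁/X³`.** [folklore] -/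
theorem hasDerivAt_farPoint (u : ℝ) :
    HasDerivAt (farPoint a b X) (-2 * b * poleDeriv X u / X u ^ 3) u := by
  have h := ((hasDerivAt_poleRatio hX hX0 u).const_mul (b / 2)).const_sub a
  refine h.congr_deriv ?_
  ring

/-- `A` is continuous. [folklore] -/
theorem continuous_farPoint : Continuous (farPoint a b X) :=
  continuous_iff_continuousAt.2 fun u ↦ (hasDerivAt_farPoint hX hX0 u).continuousAt

/-- `W̃` is continuous. [folklore] -/
theorem continuous_driver : Continuous (driver a b X) :=
  (continuous_farPoint hX hX0).add
    ((continuous_const.mul (continuous_poleDeriv hX hX0)).div hX hX0)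

omit hX hX0 in
/-- **`W̃_u = h_u(W_u)`**: the image driver is the conjugating Möbius map `moebiusConj a b P d₁ d₂`
at the driving value `W_u = P_u - X_u`. [cite: Lawler2005, §6.3] -/
theorem driver_eq_moebiusConj (u : ℝ) :
    driver a b X u = moebiusConj a b (poleFlow p X u) (poleDeriv X u) (poleDeriv₂ X u)
      (poleFlow p X u - X u) := by
  rw [moebiusConj_apply, driver, farPoint, poleDeriv₂, sub_sub_cancel]
  have hd : poleDeriv X u ≠ 0 := (poleDeriv_pos u).ne'
  field_simp

omit hX hX0 in
/-- `h_u` at the (real) driving value is the image driver, in `ℂ`. [folklore] -/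
theorem conjMap_driving (u : ℝ) :
    conjMap a b p X u ((poleFlow p X u - X u : ℝ) : ℂ) = ((driver a b X u : ℝ) : ℂ) := by
  rw [conjMap, moebiusConjC_ofReal, driver_eq_moebiusConj]

omit hX hX0 in
/-- `h_0 = N` at complex arguments: `conjMap 0 z = a + b/(p - z)`. [folklore] -/
theorem conjMap_zero (z : ℂ) : conjMap a b p X 0 z = a + b / ((p : ℂ) - z) := by
  rw [conjMap, moebiusConjC_apply, poleFlow_zero, poleDeriv_zero, poleDeriv₂_zero]
  push_cast
  ring

/-! ### The capacity clock -/

/-- The rate is continuous. [folklore] -/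
theorem continuous_rate : Continuous (rate b X) :=
  ((continuous_const.mul (continuous_poleDeriv hX hX0)).div (hX.pow 2)
    fun s ↦ pow_ne_zero 2 (hX0 s)).pow 2

/-- **`clock' = rate`.** [folklore] -/
theorem hasDerivAt_clock (u : ℝ) : HasDerivAt (clock b X) (rate b X u) u :=
  ((continuous_rate hX hX0).integral_hasStrictDerivAt 0 u).hasDerivAt

/-- The clock is continuous. [folklore] -/
theorem continuous_clock : Continuous (clock b X) :=
  continuous_iff_continuousAt.2 fun u ↦ (hasDerivAt_clock hX hX0 u).continuousAt

omit hX in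
/-- The rate is positive (`b ≠ 0`). [folklore] -/
theorem rate_pos (hb : b ≠ 0) (u : ℝ) : 0 < rate b X u := by
  rw [rate]
  have h : b * poleDeriv X u / X u ^ 2 ≠ 0 :=
    div_ne_zero (mul_ne_zero hb (poleDeriv_pos u).ne') (pow_ne_zero 2 (hX0 u))
  positivity

/-- **The clock is strictly increasing** (`b ≠ 0`). [folklore] -/
theorem strictMono_clock (hb : b ≠ 0) : StrictMono (clock b X) :=
  strictMono_of_hasDerivAt_pos (fun u ↦ hasDerivAt_clock hX hX0 u) fun u ↦ rate_pos hX0 hb u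

/-- The clock is nonnegative at nonnegative times. [folklore] -/
theorem clock_nonneg (hb : b ≠ 0) {u : ℝ} (hu : 0 ≤ u) : 0 ≤ clock b X u := by
  have h := (strictMono_clock hX hX0 hb).monotone hu
  rwa [clock_zero] at h

end Calculus

/-! ### The inverse clock -/

section InverseClock

variable {b : ℝ} {X : ℝ → ℝ} {u₁ : ℝ}

/-- **The inverse clock** `υ`: the original time at which the capacity clock reaches the level
`t`, for levels `t ∈ [clock(-1), clock(u₁ + 1)]` (clamped outside; `Function.invFunOn` of the
clock on `[-1, u₁ + 1]`). Hypothesis-free definition; its properties hold for a continuous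
nowhere-vanishing gap path and `b ≠ 0` (Lawler §6.3: the change of time `r(t)`).
[cite: Lawler2005, §6.3] -/
def invClock (b : ℝ) (X : ℝ → ℝ) (u₁ : ℝ) (t : ℝ) : ℝ :=
  Function.invFunOn (clock b X) (Icc (-1) (u₁ + 1))
    (max (clock b X (-1)) (min t (clock b X (u₁ + 1))))

variable (hX : Continuous X) (hX0 : ∀ u, X u ≠ 0) (hb : b ≠ 0) (hu₁ : 0 ≤ u₁)
include hX hX0 hb hu₁

/-- The clamped level lies in the range of the clock on `[-1, u₁ + 1]`. [folklore] -/
theorem exists_clock_eq_clampLevel (t : ℝ) :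
    ∃ u ∈ Icc (-1 : ℝ) (u₁ + 1),
      clock b X u = max (clock b X (-1)) (min t (clock b X (u₁ + 1))) := by
  have hle : (-1 : ℝ) ≤ u₁ + 1 := by linarith
  have hivt := intermediate_value_Icc hle (continuous_clock (b := b) hX hX0).continuousOn
  have hmem : max (clock b X (-1)) (min t (clock b X (u₁ + 1))) ∈
      Icc (clock b X (-1)) (clock b X (u₁ + 1)) := by
    have hmono := (strictMono_clock hX hX0 hb).monotone hle
    exact ⟨le_max_left _ _, max_le hmono (min_le_right _ _)⟩
  exact hivt hmem

/-- **The clock inverts the inverse clock** at every clamped level. [folklore] -/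
theorem clock_invClock (t : ℝ) :
    clock b X (invClock b X u₁ t) = max (clock b X (-1)) (min t (clock b X (u₁ + 1))) :=
  Function.invFunOn_eq (exists_clock_eq_clampLevel hX hX0 hb hu₁ t)

/-- The inverse clock takes values in `[-1, u₁ + 1]`. [folklore] -/
theorem invClock_mem (t : ℝ) : invClock b X u₁ t ∈ Icc (-1 : ℝ) (u₁ + 1) :=
  Function.invFunOn_mem (exists_clock_eq_clampLevel hX hX0 hb hu₁ t)

/-- For levels in the range, `clock (υ t) = t`. [folklore] -/
theorem clock_invClock_of_mem {t : ℝ} (ht : t ∈ Icc (clock b X (-1)) (clock b X (u₁ + 1))) :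
    clock b X (invClock b X u₁ t) = t := by
  rw [clock_invClock hX hX0 hb hu₁, min_eq_left ht.2, max_eq_right ht.1]

/-- **The inverse clock inverts the clock** on `[-1, u₁ + 1]`. [folklore] -/
theorem invClock_clock {u : ℝ} (hu : u ∈ Icc (-1 : ℝ) (u₁ + 1)) :
    invClock b X u₁ (clock b X u) = u := by
  have hmono := (strictMono_clock hX hX0 hb).monotone
  have ht : clock b X u ∈ Icc (clock b X (-1)) (clock b X (u₁ + 1)) := ⟨hmono hu.1, hmono hu.2⟩
  exact (strictMono_clock hX hX0 hb).injective (clock_invClock_of_mem hX hX0 hb hu₁ ht)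

omit hu₁ in
/-- The levels `[0, clock u₁]` lie strictly inside the range `(clock(-1), clock(u₁ + 1))`.
[folklore] -/
theorem Icc_subset_Ioo_clock :
    Icc 0 (clock b X u₁) ⊆ Ioo (clock b X (-1)) (clock b X (u₁ + 1)) := by
  intro t ht
  have h1 : clock b X (-1) < clock b X 0 := strictMono_clock hX hX0 hb (by norm_num)
  have h2 : clock b X u₁ < clock b X (u₁ + 1) := strictMono_clock hX hX0 hb (by linarith)
  rw [clock_zero] at h1
  exact ⟨h1.trans_le ht.1, ht.2.trans_lt h2⟩

/-- **The clock is a homeomorphism of `[-1, u₁ + 1]` onto its image interval.** [folklore] -/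
theorem exists_homeomorph_clock :
    ∃ e : Icc (-1 : ℝ) (u₁ + 1) ≃ₜ Icc (clock b X (-1)) (clock b X (u₁ + 1)),
      ∀ u : Icc (-1 : ℝ) (u₁ + 1), (e u : ℝ) = clock b X u := by
  have hle : (-1 : ℝ) ≤ u₁ + 1 := by linarith
  have hcont := continuous_clock (b := b) hX hX0
  have hmono := (strictMono_clock hX hX0 hb).monotone
  set g : Icc (-1 : ℝ) (u₁ + 1) → Icc (clock b X (-1)) (clock b X (u₁ + 1)) := fun u ↦
    ⟨clock b X u, hmono u.2.1, hmono u.2.2⟩ with hg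
  have hgc : Continuous g := (hcont.comp continuous_subtype_val).subtype_mk _
  have hinj : Function.Injective g := fun s t hst ↦
    Subtype.ext ((strictMono_clock hX hX0 hb).injective (congrArg Subtype.val hst))
  have hsurj : Function.Surjective g := by
    intro v
    obtain ⟨u, hu, huv⟩ := intermediate_value_Icc hle hcont.continuousOn v.2
    exact ⟨⟨u, hu⟩, Subtype.ext huv⟩
  have hec : Continuous (Equiv.ofBijective g ⟨hinj, hsurj⟩) := hgc
  exact ⟨hec.homeoOfEquivCompactToT2, fun u ↦ rfl⟩

/-- **The inverse clock is continuous.** [folklore] -/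
theorem continuous_invClock : Continuous (invClock b X u₁) := by
  obtain ⟨e, he⟩ := exists_homeomorph_clock hX hX0 hb hu₁
  have hle' : clock b X (-1) ≤ clock b X (u₁ + 1) :=
    (strictMono_clock hX hX0 hb).monotone (by linarith)
  set cap : ℝ → Icc (clock b X (-1)) (clock b X (u₁ + 1)) := fun t ↦
    ⟨max (clock b X (-1)) (min t (clock b X (u₁ + 1))), le_max_left _ _,
      max_le hle' (min_le_right _ _)⟩ with hcap
  have hcapc : Continuous cap :=
    (continuous_const.max (continuous_id.min continuous_const)).subtype_mk _
  have hformula : invClock b X u₁ = fun t ↦ ((e.symm (cap t) : Icc (-1 : ℝ) (u₁ + 1)) : ℝ) := by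
    funext t
    apply (strictMono_clock hX hX0 hb).injective
    rw [clock_invClock hX hX0 hb hu₁, ← he (e.symm (cap t)), Homeomorph.apply_symm_apply]
  rw [hformula]
  exact continuous_subtype_val.comp (e.symm.continuous.comp hcapc)

/-- **The inverse clock is differentiable with derivative `1/rate`**: `υ'(t) = 1/rate(υ t)` for
levels strictly inside the range (inverse function rule). [folklore] -/
theorem hasDerivAt_invClock {t : ℝ} (ht : t ∈ Ioo (clock b X (-1)) (clock b X (u₁ + 1))) :
    HasDerivAt (invClock b X u₁) (rate b X (invClock b X u₁ t))⁻¹ t := by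
  have hne : rate b X (invClock b X u₁ t) ≠ 0 := (rate_pos hX0 hb _).ne'
  refine HasDerivAt.of_local_left_inverse (continuous_invClock hX hX0 hb hu₁).continuousAt
    (hasDerivAt_clock hX hX0 (invClock b X u₁ t)) hne ?_
  filter_upwards [isOpen_Ioo.mem_nhds ht] with s hs
  exact clock_invClock_of_mem hX hX0 hb hu₁ ⟨hs.1.le, hs.2.le⟩

/-- The inverse clock is monotone. [folklore] -/
theorem monotone_invClock : Monotone (invClock b X u₁) := by
  intro s t hst
  by_contra hlt
  push Not at hlt
  have h := strictMono_clock hX hX0 hb hlt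
  rw [clock_invClock hX hX0 hb hu₁, clock_invClock hX hX0 hb hu₁] at h
  have : max (clock b X (-1)) (min s (clock b X (u₁ + 1))) ≤
      max (clock b X (-1)) (min t (clock b X (u₁ + 1))) :=
    max_le_max le_rfl (min_le_min hst le_rfl)
  exact absurd h (not_lt.2 this)

/-- `υ 0 = 0`. [folklore] -/
theorem invClock_zero : invClock b X u₁ 0 = 0 := by
  have h := invClock_clock hX hX0 hb hu₁ (u := 0) ⟨by norm_num, by linarith⟩
  rwa [clock_zero] at h

/-- On `[0, clock u₁]` the inverse clock takes values in `[0, u₁]`. [folklore] -/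
theorem invClock_mem_Icc {t : ℝ} (ht : t ∈ Icc 0 (clock b X u₁)) :
    invClock b X u₁ t ∈ Icc 0 u₁ := by
  have h0 := monotone_invClock hX hX0 hb hu₁ ht.1
  have h1 := monotone_invClock hX hX0 hb hu₁ ht.2
  rw [invClock_zero hX hX0 hb hu₁] at h0
  rw [invClock_clock hX hX0 hb hu₁ ⟨by linarith, by linarith⟩] at h1
  exact ⟨h0, h1⟩

/-- On `[0, clock u₁)` the inverse clock takes values in `[0, u₁)`. [folklore] -/
theorem invClock_lt {t : ℝ} (ht0 : 0 ≤ t) (ht : t < clock b X u₁) : invClock b X u₁ t < u₁ := by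
  by_contra hle
  push Not at hle
  have h := (strictMono_clock hX hX0 hb).monotone hle
  rw [clock_invClock_of_mem hX hX0 hb hu₁
    (Ioo_subset_Icc_self (Icc_subset_Ioo_clock hX hX0 hb ⟨ht0, ht.le⟩))] at h
  exact absurd ht (not_lt.2 h)

end InverseClock

/-! ### The image flow in capacity time -/

section CapacityTime

variable {a b p : ℝ} {X : ℝ → ℝ} {u₁ : ℝ}
variable (hX : Continuous X) (hX0 : ∀ u, X u ≠ 0) (hb : b ≠ 0) (hu₁ : 0 ≤ u₁)
include hX hX0 hb hu₁

omit hX hX0 hb hu₁ in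
/-- The real `rate`, read in `ℂ`, is the square of `h_u'(W_u) = b d₁/(P - W)²`. [folklore] -/
theorem ofReal_rate_eq_sq (u : ℝ) :
    ((rate b X u : ℝ) : ℂ) =
      (((b * poleDeriv X u / (poleFlow p X u - (poleFlow p X u - X u)) ^ 2 : ℝ) : ℂ)) ^ 2 := by
  rw [rate, sub_sub_cancel]
  push_cast
  ring

/-- **The image of a Loewner trajectory solves Loewner's equation in capacity time** (Lawler
§6.3: "the maps `g*_t` satisfy `ġ* = 2Φ_t'(U_t)²/(g* - U*)`", and after the change of time
`r(t)`, "`dh̃_t(z)/dt = 2/(h̃_t(z) - Ũ*_t)`"). If at the original time `u = υ t` the complex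
trajectory `Y` moves by the Loewner field of the driving value `W_u = P_u - X_u`,
`Ẏ = 2/(Y - W_u)`, off `P_u` and `W_u`, then the image point `t ↦ h_{υ t}(Y_{υ t})` moves by
`2/(h_u(Y_u) - W̃_u)` at `t`, `W̃ = driver`. [cite: Lawler2005, §6.3] -/
theorem hasDerivAt_conjMap_invClock {t : ℝ}
    (ht : t ∈ Ioo (clock b X (-1)) (clock b X (u₁ + 1))) {Y : ℝ → ℂ}
    (hY : HasDerivAt Y (2 / (Y (invClock b X u₁ t) -
      ((poleFlow p X (invClock b X u₁ t) - X (invClock b X u₁ t) : ℝ) : ℂ))) (invClock b X u₁ t))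
    (hYP : Y (invClock b X u₁ t) ≠ poleFlow p X (invClock b X u₁ t))
    (hYW : Y (invClock b X u₁ t) ≠
      ((poleFlow p X (invClock b X u₁ t) - X (invClock b X u₁ t) : ℝ) : ℂ)) :
    HasDerivAt (fun r ↦ conjMap a b p X (invClock b X u₁ r) (Y (invClock b X u₁ r)))
      (2 / (conjMap a b p X (invClock b X u₁ t) (Y (invClock b X u₁ t)) -
        driver a b X (invClock b X u₁ t))) t := by
  set u := invClock b X u₁ t with hu
  set W : ℝ := poleFlow p X u - X u with hW
  have hPW : poleFlow p X u - W = X u := by rw [hW, sub_sub_cancel]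
  have hPW' : poleFlow p X u ≠ W := fun h ↦ hX0 u (by rw [← hPW, h, sub_self])
  have hd₁0 : poleDeriv X u ≠ 0 := (poleDeriv_pos u).ne'
  -- the pole ODEs in the shape consumed by `LoewnerMoebiusConjugation`
  have hP : HasDerivAt (poleFlow p X) (2 / (poleFlow p X u - W)) u := by
    rw [hPW]; exact hasDerivAt_poleFlow hX hX0 u
  have hd₁ : HasDerivAt (poleDeriv X) (-2 * poleDeriv X u / (poleFlow p X u - W) ^ 2) u := by
    rw [hPW]; exact hasDerivAt_poleDeriv hX hX0 u
  have hd₂ : HasDerivAt (poleDeriv₂ X) (-2 * poleDeriv₂ X u / (poleFlow p X u - W) ^ 2 +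
      4 * poleDeriv X u ^ 2 / (poleFlow p X u - W) ^ 3) u := by
    rw [hPW]; exact hasDerivAt_poleDeriv₂ hX hX0 u
  have htraj := hasDerivAt_moebiusConjC_trajectory (a := a) (b := b) hP hd₁ hd₂ hPW' hd₁0 hY
    hYP hYW
  -- compose with the inverse clock
  have hυ := hasDerivAt_invClock hX hX0 hb hu₁ ht
  have hcomp := htraj.scomp t hυ
  have hfun : ((fun s ↦ moebiusConjC a b (poleFlow p X s) (poleDeriv X s) (poleDeriv₂ X s) (Y s)) ∘
      invClock b X u₁) = fun r ↦ conjMap a b p X (invClock b X u₁ r) (Y (invClock b X u₁ r)) := by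
    funext r; rfl
  rw [hfun] at hcomp
  refine hcomp.congr_deriv ?_
  rw [← hu, Complex.real_smul, conjMap, driver_eq_moebiusConj (p := p), ← moebiusConjC_ofReal,
    ← hW]
  have hsq : (((b * poleDeriv X u / (poleFlow p X u - W) ^ 2 : ℝ) : ℂ)) ^ 2 = ((rate b X u : ℝ) : ℂ) := by
    rw [ofReal_rate_eq_sq (p := p) u, hW]
  rw [hsq]
  have hr : ((rate b X u : ℝ) : ℂ) ≠ 0 := Complex.ofReal_ne_zero.2 (rate_pos hX0 hb u).ne'
  have hr' : (((rate b X u)⁻¹ : ℝ) : ℂ) = ((rate b X u : ℝ) : ℂ)⁻¹ := Complex.ofReal_inv _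
  rw [hr']
  field_simp

/-- **The image far point solves the real Loewner equation in capacity time**:
`d/dt A_{υ t} = 2/(A_{υ t} - W̃_{υ t})` (the real point `a = N(∞)` flows under the image chain;
`Ȧ = -2 b d₁/X³`, `υ' = X⁴/(b d₁)²`, `A - W̃ = -b d₁/X`). [cite: Lawler2005, §6.3] -/
theorem hasDerivAt_farPoint_invClock {t : ℝ}
    (ht : t ∈ Ioo (clock b X (-1)) (clock b X (u₁ + 1))) :
    HasDerivAt (fun r ↦ farPoint a b X (invClock b X u₁ r))
      (2 / (farPoint a b X (invClock b X u₁ t) - driver a b X (invClock b X u₁ t))) t := by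
  set u := invClock b X u₁ t with hu
  have hυ := hasDerivAt_invClock hX hX0 hb hu₁ ht
  have hA := hasDerivAt_farPoint (a := a) (b := b) hX hX0 u
  have hcomp := hA.comp t hυ
  have hfun : (farPoint a b X ∘ invClock b X u₁) = fun r ↦ farPoint a b X (invClock b X u₁ r) := by
    funext r; rfl
  rw [hfun] at hcomp
  refine hcomp.congr_deriv ?_
  rw [← hu, farPoint_sub_driver, rate]
  have hXu : X u ≠ 0 := hX0 u
  have hd : poleDeriv X u ≠ 0 := (poleDeriv_pos u).ne'
  field_simp

end CapacityTime

/-! ### The image driving function in capacity time -/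

section TimeChanged

open scoped NNReal

/-- **The image driving function in capacity time** `U_t = W̃_{υ t} = h_{υt}(W_{υt})`
(Lawler §6.3: `Ũ*_t := U*_{r(t)}`), as a function on `ℝ≥0`; frozen junk beyond the level
`clock (u₁ + 1)`. [cite: Lawler2005, §6.3] -/
def timeChangedDriver (a b : ℝ) (X : ℝ → ℝ) (u₁ : ℝ) (t : ℝ≥0) : ℝ :=
  driver a b X (invClock b X u₁ t)

variable {a b : ℝ} {X : ℝ → ℝ} {u₁ : ℝ}
variable (hX : Continuous X) (hX0 : ∀ u, X u ≠ 0) (hb : b ≠ 0) (hu₁ : 0 ≤ u₁)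
include hX hX0 hb hu₁

omit hX hX0 hb hu₁ in
/-- Unfolding of `timeChangedDriver`. [folklore] -/
theorem timeChangedDriver_apply (t : ℝ≥0) :
    timeChangedDriver a b X u₁ t = driver a b X (invClock b X u₁ t) := rfl

/-- The image driving function in capacity time is continuous. [folklore] -/
theorem continuous_timeChangedDriver : Continuous (timeChangedDriver a b X u₁) :=
  (continuous_driver hX hX0).comp ((continuous_invClock hX hX0 hb hu₁).comp NNReal.continuous_coe)

/-- **Undoing the time change**: at the clock of an original time `u ∈ [0, u₁]`,
`U_{clock u} = W̃_u`. [folklore] -/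
theorem timeChangedDriver_clock {u : ℝ} (hu : u ∈ Icc 0 u₁) :
    timeChangedDriver a b X u₁ (clock b X u).toNNReal = driver a b X u := by
  rw [timeChangedDriver, Real.coe_toNNReal _ (clock_nonneg hX hX0 hb hu.1),
    invClock_clock hX hX0 hb hu₁ ⟨by linarith [hu.1], by linarith [hu.2]⟩]

/-- `U_0 = W̃_0 = a + b/X_0` (`= N(W_0)`). [folklore] -/
theorem timeChangedDriver_zero : timeChangedDriver a b X u₁ 0 = a + b / X 0 := by
  rw [timeChangedDriver, NNReal.coe_zero, invClock_zero hX hX0 hb hu₁, driver_zero]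

end TimeChanged

/-! ### Change of variables along the capacity clock -/

section ChangeOfVariables

variable {b : ℝ} {X : ℝ → ℝ} {u₁ : ℝ}
variable (hX : Continuous X) (hX0 : ∀ u, X u ≠ 0) (hb : b ≠ 0) (hu₁ : 0 ≤ u₁)
include hX hX0 hb hu₁

/-- **Change of variables along the capacity clock**: for a continuous `F` and `u ∈ [0, u₁]`,
`∫₀^{clock u} F(υ s) ds = ∫₀ᵘ F(r) rate(r) dr` (substitute `s = clock r`, `clock' = rate`,
`υ (clock r) = r`). [folklore] -/
theorem integral_comp_invClock {F : ℝ → ℝ} (hF : Continuous F) {u : ℝ} (hu : u ∈ Icc 0 u₁) :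
    ∫ s in (0 : ℝ)..clock b X u, F (invClock b X u₁ s) = ∫ r in (0 : ℝ)..u, F r * rate b X r := by
  have hderiv : ∀ r ∈ uIcc 0 u, HasDerivAt (clock b X) (rate b X r) r := fun r _ ↦
    hasDerivAt_clock hX hX0 r
  have hcont : ContinuousOn (rate b X) (uIcc 0 u) := (continuous_rate hX hX0).continuousOn
  have hG : ContinuousOn (fun s ↦ F (invClock b X u₁ s)) (clock b X '' uIcc 0 u) :=
    (hF.comp (continuous_invClock hX hX0 hb hu₁)).continuousOn
  have h := intervalIntegral.integral_comp_mul_deriv' hderiv hcont hG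
  rw [clock_zero] at h
  rw [← h]
  refine intervalIntegral.integral_congr fun r hr ↦ ?_
  rw [uIcc_of_le hu.1] at hr
  simp only [Function.comp_apply]
  rw [invClock_clock hX hX0 hb hu₁ ⟨by linarith [hr.1], by linarith [hr.2, hu.2]⟩]

/-- **The jet `d₁` is a functional of the image gap in capacity time**: with the image gap
`X̂_s = -b d₁(υ s)/X_{υ s}` of the tracked real point (`realFlowStop_imageDriver_far` of
`LoewnerMoebiusImageChain`), `∫₀^{clock u} 2/X̂_s² ds = ∫₀ᵘ 2/X_r² dr`, hence
`exp(-∫₀^{clock u} 2/X̂²) = d₁(u)` (`u ∈ [0, u₁]`). [cite: Lawler2005, §6.3] -/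
theorem integral_two_div_imageGap_sq {u : ℝ} (hu : u ∈ Icc 0 u₁) :
    ∫ s in (0 : ℝ)..clock b X u,
        2 / (-(b * poleDeriv X (invClock b X u₁ s) / X (invClock b X u₁ s))) ^ 2 =
      ∫ r in (0 : ℝ)..u, 2 / X r ^ 2 := by
  have hF : Continuous fun r ↦ 2 / (-(b * poleDeriv X r / X r)) ^ 2 :=
    continuous_const.div (((continuous_const.mul (continuous_poleDeriv hX hX0)).div hX hX0).neg.pow 2)
      fun r ↦ pow_ne_zero 2 (neg_ne_zero.2 (div_ne_zero (mul_ne_zero hb (poleDeriv_pos r).ne')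
        (hX0 r)))
  rw [integral_comp_invClock hX hX0 hb hu₁ hF hu]
  refine intervalIntegral.integral_congr fun r _ ↦ ?_
  simp only [rate]
  have hXr : X r ≠ 0 := hX0 r
  have hd : poleDeriv X r ≠ 0 := (poleDeriv_pos r).ne'
  field_simp

/-- The same identity under the exponential: `exp(-∫₀^{clock u} 2/X̂²) = d₁(u)`. [cite: Lawler2005, §6.3] -/
theorem exp_neg_integral_imageGap {u : ℝ} (hu : u ∈ Icc 0 u₁) :
    Real.exp (-∫ s in (0 : ℝ)..clock b X u,
        2 / (-(b * poleDeriv X (invClock b X u₁ s) / X (invClock b X u₁ s))) ^ 2) =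
      poleDeriv X u := by
  rw [integral_two_div_imageGap_sq hX hX0 hb hu₁ hu, poleDeriv]

/-- **The original time is a functional of the image gap in capacity time**:
`∫₀^{clock u} (b Ĵ_s/X̂_s²)² ds = u` with `Ĵ_s = d₁(υ s)`, `X̂_s = -b d₁(υ s)/X_{υ s}` (the
integrand is `1/rate (υ s)`; `u ∈ [0, u₁]`). Symmetric to the definition of the clock: the
inverse Möbius map has the same shape. [cite: Lawler2005, §6.3] -/
theorem integral_imageRate_eq {u : ℝ} (hu : u ∈ Icc 0 u₁) :
    ∫ s in (0 : ℝ)..clock b X u,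
        (b * poleDeriv X (invClock b X u₁ s) /
          (-(b * poleDeriv X (invClock b X u₁ s) / X (invClock b X u₁ s))) ^ 2) ^ 2 = u := by
  have hF : Continuous fun r ↦ (b * poleDeriv X r / (-(b * poleDeriv X r / X r)) ^ 2) ^ 2 :=
    ((continuous_const.mul (continuous_poleDeriv hX hX0)).div
      (((continuous_const.mul (continuous_poleDeriv hX hX0)).div hX hX0).neg.pow 2)
      fun r ↦ pow_ne_zero 2 (neg_ne_zero.2 (div_ne_zero (mul_ne_zero hb (poleDeriv_pos r).ne')
        (hX0 r)))).pow 2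
  rw [integral_comp_invClock hX hX0 hb hu₁ hF hu]
  have h1 : ∫ r in (0 : ℝ)..u, (b * poleDeriv X r / (-(b * poleDeriv X r / X r)) ^ 2) ^ 2 * rate b X r =
      ∫ r in (0 : ℝ)..u, (1 : ℝ) := by
    refine intervalIntegral.integral_congr fun r _ ↦ ?_
    simp only [rate]
    have hXr : X r ≠ 0 := hX0 r
    have hd : poleDeriv X r ≠ 0 := (poleDeriv_pos r).ne'
    field_simp
  rw [h1, intervalIntegral.integral_const, smul_eq_mul, mul_one, sub_zero]

end ChangeOfVariables

end MoebiusPole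

end Literature.Probability.RandomPlanarGeometry

end
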